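import Summits.CriticalPhenomena.PercolationContinuityZ3.Theorems.Transplant.BoxProdZ2DropAssembly
import Summits.CriticalPhenomena.PercolationContinuityZ3.Theorems.Transplant.KNCells2TubePackaging
import Summits.CriticalPhenomena.PercolationContinuityZ3.Theorems.Transplant.KNCells2RootChain
import HarnessLib

/-!
# The NAMED RESIDUES of the (D) node in the tube-packaging vocabulary, CHOSEN-EDGE form: `RootObl` (generic); `RootOblT`,
# `FaceOblAt` / `FaceOblC`, `ReachOblAt` / `ReachOblC` over `X □ ℤ²` (the hypothesis lists of p2-g2's `hQ0_of_chain_sub`, `cond_of_tubeStep`,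
# `hreach_of_tubeChain` minus their generic chain / step properties) and their discharges into the three conjuncts of the node's obligations

builds on p205010 (kernel theorem, internal audit signed; external expert review pending) — nothing in this file uses p205010.
Lane `prim-bschramm-*`, seat `prim-bschramm-stmt` (gen 5); helper file (`--supports stmt-CriticalPhenomena-4575`).

WHY the chosen-edge form (refuter p5-g3 14:41Z, lead 14:42:13Z): `lawful₂` consumes the face / corridor inputs only at the scheme's CHOSEN
candidate edge (`(S.astOf₂ G h).st.choice = some e`), while `KSchA.KitAt` (stmt p220287) asks them for every `(h, e)` with `Valid₂ h e`; for
the position-dependent concentric schedule the surplus generality is unprovable (an un-replayed hypothetical source has cube radius `E(2)`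
above its far box `F(2)`).  So the residues below carry the extra premise `choice = some e`; p5-g3's `theta_pos_of_kit₂_chosen(')`
(KNCells2ThetaPosChosen, p221346) and bundled predicate `KitAtChosen` (KNCells2KitAtChosen) consume them — the composition is stmt's
`BoxProdZ2ConcClosure`.
* `KSchA.RootObl G S` — (32) at the root, VERBATIM the first conjunct of `KitAt` / the `hQ0` hypothesis of the node theorems.
* `KSchA.RootOblT X S Δ' δr` — per direction a linked chain of tube target steps of some length `n + 1` under the root law cut to a sub-world
  `U'`, kits at accuracy `δr n`, rim excess, source bound, last true target in `M_{a₀}(0+du)` (hypotheses of `hQ0_of_chain_sub` minus `hchain`);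
  `rootObl_of_rootOblT`.
* `KSchA.FaceOblAt X S FD Δ' δ₂ h e a a' du j o` — `∃ (P : TubeStepData W) T' η`: hypotheses of `cond_of_tubeStep` minus `hstep`, `hsrc`;
  `FaceOblC` (all chosen valid `(h, e)`, onward `du`, `j < K`, `o`, at `(aOf₁, aOf₂)`); `cond_of_faceOblAt`.
* `KSchA.ReachOblAt X S FD Δ' δ h e a' du` — `∃ (P : TubeChainData W) π' η`: hypotheses of `hreach_of_tubeChain` minus `hchain`, `hδc`;
  `ReachOblC`; `reach_of_reachOblAt`.
The generic step / chain properties these discharges ask for (`hstep` at `(δ₂ ↦ δc/2)`, `hchain` at `(δ ↦ ε'')` of length `nLast + 1`, and of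
every length at `(δr n ↦ δc)` for the root) are supplied for ALL parameters at once by `BoxProdZ2ChainUP` (U2).
[cite: KozmaNitzan2024, §4 (30), (32) (pp. 27–28), Lemma 10 (p. 17), Lemmas 11–12 (pp. 22–25), p. 30 (Steps III–IV)]
-/

noncomputable section

open MeasureTheory ProbabilityTheory
open scoped ENNReal Classical

namespace Summit.CriticalPhenomena.PercolationContinuityZ3.Theorems

namespace Transplant

namespace KNCells

open Literature.Probability.Percolation Literature.Probability.LatticeModels SimpleGraph GadgetSystem ProbeHistory HSiteScheme Contour
open BoxProdZ2

namespace KSchA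

/-! ## §1 The root obligation (generic graph) -/

section Generic

variable {V : Type} [DecidableEq V] [Countable V] {A : Type*}

/-- **The root obligation (32)** of the anchored-cells scheme `S` on `G` — VERBATIM the first conjunct of `KSchA.KitAt` (design (D): the root
probe, D8). [cite: KozmaNitzan2024, §4 (32) (pp. 27–28)] -/
def RootObl (G : SimpleGraph V) [G.LocallyFinite] (S : KSchA V A) : Prop :=
  ∀ du : MDir, 1 - S.δc < (prodBernoulli (pinW (KNLevels.lattW G S.p) ↑(S.U₀ G) ↑(S.U₀ G))).real
      (⋃ t ∈ (↑(S.Γ.M S.Γ.a₀ ((0 : Site 2) + stepVec du)) : Set V),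
        openConnIn (↑(S.Γ.Q S.Γ.a₀ 0 ∪ S.Γ.Ewv S.Γ.a₀ 0 du) : Set V) S.Γ.root t)

end Generic

/-! ## §2 The residues over `X □ ℤ²` in the tube-packaging vocabulary -/

variable {W : Type} [DecidableEq W] [Countable W] (X : SimpleGraph W) [X.LocallyFinite]
variable {A : Type*}

/-- **The root obligation in tube form** (D8): for every direction `du` a linked chain of `n + 1` target steps in a tube graph of `X` with
common source the root, under the root law cut to a sub-world `U' ⊆ Q_0 ∪ E_{0,du}` containing the root, kits at accuracy `δr n`, true targets
inside the enlarged ones with excess `≤ η ≤ δr n / 2`, the source bound `1 - δr n < P((s 0).reachB)` (the monotone-wired first hop) and the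
last true target inside `M_{a₀}(0 + du)` — the hypotheses of p2-g2's `hQ0_of_chain_sub` except the chain property.
[cite: KozmaNitzan2024, §4 p. 27 (G₀), p. 28 ((32) at the root), Lemma 12 (pp. 23–25)] -/
def RootOblT (S : KSchA (W × Site 2) A) (Δ' : ℕ) (δr : ℕ → ℝ) : Prop :=
  ∀ du : MDir, ∃ (n : ℕ) (π : Finset W) (U' : Finset (W × Site 2))
    (s : Fin (n + 1) → KNLevels.TStep (tubeGraph X π)) (T' : Fin (n + 1) → Finset (W × Site 2)) (η : ℝ),
    U' ⊆ S.U0root du ∧ S.Γ.root ∈ U' ∧ (∀ i : Fin (n + 1), (s i).L.o = S.Γ.root) ∧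
    (∀ i : Fin n, T' (Fin.castSucc i) ⊆ (s i.succ).L.X 0) ∧ (∀ i : Fin (n + 1), T' i ⊆ (s i).T) ∧
    (∀ i : Fin (n + 1), (s i).KitsAt (S.W0sub (X □ zdGraph 2) U') S.p Δ' (δr n)) ∧ η ≤ δr n / 2 ∧
    (∀ i : Fin (n + 1), (prodBernoulli (S.W0sub (X □ zdGraph 2) U')).real (⋃ t ∈ (s i).T \ T' i, openConn S.Γ.root t) ≤ η) ∧
    1 - δr n < (prodBernoulli (S.W0sub (X □ zdGraph 2) U')).real (s 0).L.reachB ∧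
    T' (Fin.last n) ⊆ S.Γ.M S.Γ.a₀ ((0 : Site 2) + stepVec du)

/-- **The face obligation at one face** `(h, e, a, a', du, j, o)`: a tube step `P` rooted at the scheme's root whose first level contains
`F^{j+1}`, with the subbox / support facts of the law `Wt`, Step II's count at accuracy `δ₂`, the per-level kit clause at accuracy `δ₂`
(`kitClauseQ`'s conclusion), a true target `T' ⊆ M^{a'}_{x+du}` inside the enlarged target and the rim excess `≤ η ≤ δc/2` — the hypotheses of
p2-g2's `cond_of_tubeStep` except the generic one-step property and the source bound. [cite: KozmaNitzan2024, §4 p. 30 (Step III), Lemma 10 (p. 17)] -/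
def FaceOblAt (S : KSchA (W × Site 2) A) (FD : FaceData (W × Site 2) A) (Δ' : ℕ) (δ₂ : ℝ) (h : ProbeHistory (W × Site 2))
    (e : Site 2 × MDir) (a a' : A) (du : MDir) (j : ℕ) (o : Finset (Sym2 (W × Site 2))) : Prop :=
  ∃ (P : TubeStepData W) (T' : Finset (W × Site 2)) (η : ℝ),
    P.root = S.Γ.root ∧
    KNLevels.IsSubbox (tubeGraph X P.π) (S.Wt (X □ zdGraph 2) h e a a' du j o) S.p P.Rg ∧
    KNLevels.FinSupp (S.Wt (X □ zdGraph 2) h e a a' du j o) P.Sfin ∧ P.Rg ⊆ P.Sfin ∧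
    Finset.Icc (P.lo - ((P.Rlev + 1 : ℕ) : Site 2)) (P.hi + ((P.Rlev + 1 : ℕ) : Site 2)) ⊆ P.Dpl ∧
    P.root ∉ P.Rg ∧ P.root ∈ P.Sfin ∧ P.j₁ ≤ P.Rlev ∧ P.T ⊆ P.Rg ∧ P.T.Nonempty ∧
    1 / (1 - (S.p : ℝ)) ^ (Δ' * P.N) ≤ δ₂ * ((Finset.Icc P.j₀ P.j₁).card : ℝ) ∧
    (∀ j' ∈ Finset.Icc P.j₀ P.j₁, ∃ (σ : KNLevels.SData (W × Site 2)) (Sz : Finset (W × Site 2)),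
      KNLevels.SHyp (tubeLData X P.π P.lo P.hi P.root P.Sfin) j' σ ∧ σ.N ≤ P.N ∧
      (1 - (S.p : ℝ) ^ σ.sB) ^ σ.k ≤ δ₂ ∧ Sz ⊆ (tubeLData X P.π P.lo P.hi P.root P.Sfin).X j' ∧ Sz ⊆ P.Rg ∧
      (∀ x ∈ σ.K, ∀ e' ∈ σ.seed x, e' ∉ wireSet (↑Sz : Set (W × Site 2))) ∧ (∀ x ∈ σ.K, σ.face x ⊆ Sz) ∧
      (∀ x ∈ σ.K, 1 - 3 * δ₂ ≤ (prodBernoulli (S.Wt (X □ zdGraph 2) h e a a' du j o)).real {ω | ∃ u ∈ σ.face x,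
        1 - δ₂ < (prodBernoulli (pinW (S.Wt (X □ zdGraph 2) h e a a' du j o) (wireSet (↑Sz : Set (W × Site 2))) ω)).real
          (⋃ t ∈ P.T, openConnIn (↑P.Rg : Set (W × Site 2)) u t)})) ∧
    T' ⊆ P.T ∧ T' ⊆ S.Γ.M a' (tgt e + stepVec du) ∧
    (prodBernoulli (S.Wt (X □ zdGraph 2) h e a a' du j o)).real (⋃ t ∈ P.T \ T', openConn S.Γ.root t) ≤ η ∧ η ≤ S.δc / 2 ∧
    FD.Face a' (tgt e) du (j + 1) ⊆ (P.Lv X).X 0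

/-- **The face obligations of the scheme, chosen-edge form**: `FaceOblAt` for every history whose chosen candidate is `e`, valid, every
onward direction, every `j < K` and every `o`, at the history anchors `(aOf₁, aOf₂)`. [cite: KozmaNitzan2024, §4 p. 30 (Steps III–IV)] -/
def FaceOblC (S : KSchA (W × Site 2) A) (FD : FaceData (W × Site 2) A) (Δ' : ℕ) (δ₂ : ℝ) : Prop :=
  ∀ h e, (S.astOf₂ (X □ zdGraph 2) h).st.choice = some e → S.Valid₂ (X □ zdGraph 2) h e →
    ∀ du ∈ S.onward (X □ zdGraph 2) h (tgt e), ∀ j < S.Γ.K, ∀ o : Finset (Sym2 (W × Site 2)),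
      FaceOblAt X S FD Δ' δ₂ h e (S.aOf₁ (X □ zdGraph 2) h e) (S.aOf₂ (X □ zdGraph 2) h e) du j o

/-- **The corridor obligation at one probe** `(h, e, a', du)`: a tube corridor chain `P` rooted at the scheme's root with the schedule
arithmetic (`r = 4t`, `100 R' ≤ t`, `Rlev + 1 ≤ R'`), rim parts inside the step regions, Step II's count at accuracy `δ`, the subbox /
support facts of the law `Wcor`, the per-step kit clauses at accuracy `δ`, the rim excess `≤ η ≤ δ/2`, the arrival cube inside `π' × M_x` and the
last true target inside `M^{a'}_{x+du}` — the hypotheses of p2-g2's `hreach_of_tubeChain` except the generic chain property and `δc ≤ δ`.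
[cite: KozmaNitzan2024, §4 Lemma 12 (pp. 23–25), p. 30 (Step IV)] -/
def ReachOblAt (S : KSchA (W × Site 2) A) (FD : FaceData (W × Site 2) A) (Δ' : ℕ) (δ : ℝ) (h : ProbeHistory (W × Site 2))
    (e : Site 2 × MDir) (a' : A) (du : MDir) : Prop :=
  ∃ (P : TubeChainData W) (π' : Finset W) (η : ℝ),
    P.root = S.Γ.root ∧ P.C.r = 4 * P.t ∧ 100 * P.R' ≤ P.t ∧ P.Rlev + 1 ≤ P.R' ∧ (∀ i, P.Rim i ⊆ P.stepD i) ∧ P.π.Nonempty ∧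
    P.j₁ ≤ P.Rlev ∧ 1 / (1 - (S.p : ℝ)) ^ (Δ' * P.N) ≤ δ * ((Finset.Icc P.j₀ P.j₁).card : ℝ) ∧
    (∀ i ≤ ChainPlanar.Sched.nLast,
      KNLevels.IsSubbox (tubeGraph X P.π) (S.Wcor (X □ zdGraph 2) FD h e (S.aOf₁ (X □ zdGraph 2) h e) a' du) S.p (P.stepD i)) ∧
    KNLevels.FinSupp (S.Wcor (X □ zdGraph 2) FD h e (S.aOf₁ (X □ zdGraph 2) h e) a' du) P.Sfin ∧
    (∀ i ≤ ChainPlanar.Sched.nLast, P.stepD i ⊆ P.Sfin) ∧ (∀ i ≤ ChainPlanar.Sched.nLast, P.root ∉ P.stepD i) ∧ P.root ∈ P.Sfin ∧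
    (∀ i ≤ ChainPlanar.Sched.nLast, ∀ j ∈ Finset.Icc P.j₀ P.j₁,
      ∃ (σ : KNLevels.SData (W × Site 2)) (Sz : Finset (W × Site 2)),
      KNLevels.SHyp (tubeLData X P.π (P.lo i) (P.hi i) P.root P.Sfin) j σ ∧ σ.N ≤ P.N ∧
      (1 - (S.p : ℝ) ^ σ.sB) ^ σ.k ≤ δ ∧ Sz ⊆ (tubeLData X P.π (P.lo i) (P.hi i) P.root P.Sfin).X j ∧ Sz ⊆ P.stepD i ∧
      (∀ x ∈ σ.K, ∀ e' ∈ σ.seed x, e' ∉ wireSet (↑Sz : Set (W × Site 2))) ∧ (∀ x ∈ σ.K, σ.face x ⊆ Sz) ∧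
      (∀ x ∈ σ.K, 1 - 3 * δ ≤ (prodBernoulli (S.Wcor (X □ zdGraph 2) FD h e (S.aOf₁ (X □ zdGraph 2) h e) a' du)).real {ω | ∃ u ∈ σ.face x,
        1 - δ < (prodBernoulli (pinW (S.Wcor (X □ zdGraph 2) FD h e (S.aOf₁ (X □ zdGraph 2) h e) a' du)
          (wireSet (↑Sz : Set (W × Site 2))) ω)).real (⋃ t ∈ P.tgtE i, openConnIn (↑(P.stepD i) : Set (W × Site 2)) u t)})) ∧
    η ≤ δ / 2 ∧
    (∀ i ≤ ChainPlanar.Sched.nLast, (prodBernoulli (S.Wcor (X □ zdGraph 2) FD h e (S.aOf₁ (X □ zdGraph 2) h e) a' du)).real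
      (⋃ t ∈ P.Rim i, openConn S.Γ.root t) ≤ η) ∧
    π' ⊆ P.π ∧ S.Γ.M (S.aOf₁ (X □ zdGraph 2) h e) (tgt e) ⊆ π' ×ˢ P.C.M P.x ∧
    P.π ×ˢ (P.C.M (P.x + stepVec P.du) ∩ P.C.Hfull P.x P.du) ⊆ S.Γ.M a' (tgt e + stepVec du)

/-- **The corridor obligations of the scheme, chosen-edge form**: `ReachOblAt` for every history whose chosen candidate is `e`, valid, and
every onward direction, at `a' = aOf₂`. [cite: KozmaNitzan2024, §4 p. 30 (Step IV), Lemma 12 (pp. 23–25)] -/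
def ReachOblC (S : KSchA (W × Site 2) A) (FD : FaceData (W × Site 2) A) (Δ' : ℕ) (δ : ℝ) : Prop :=
  ∀ h e, (S.astOf₂ (X □ zdGraph 2) h).st.choice = some e → S.Valid₂ (X □ zdGraph 2) h e →
    ∀ du ∈ S.onward (X □ zdGraph 2) h (tgt e), ReachOblAt X S FD Δ' δ h e (S.aOf₂ (X □ zdGraph 2) h e) du

/-! ## §3 Discharging the three conjuncts from the residues -/

variable {X}
variable {S : KSchA (W × Site 2) A} {FD : FaceData (W × Site 2) A}
variable {h : ProbeHistory (W × Site 2)} {e : Site 2 × MDir} {a a' : A} {du : MDir}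

/-- **`RootOblT` + the chain property of every length at `(δr n ↦ δc)` ⟹ `RootObl`** (`hQ0_of_chain_sub`).
[cite: KozmaNitzan2024, §4 p. 28 ((32) at the root), Lemma 12 (pp. 23–25)] -/
theorem rootObl_of_rootOblT {Δ' : ℕ} {δr : ℕ → ℝ}
    (hchain : ∀ (n : ℕ) (π : Finset W) (Wg : Sym2 (W × Site 2) → unitInterval) (s : Fin (n + 1) → KNLevels.TStep (tubeGraph X π))
      (T' : Fin (n + 1) → Finset (W × Site 2)) (η : ℝ),
      (∀ i : Fin (n + 1), (s i).L.o = (s 0).L.o) →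
      (∀ i : Fin n, T' (Fin.castSucc i) ⊆ (s i.succ).L.X 0) →
      (∀ i : Fin (n + 1), T' i ⊆ (s i).T) →
      (∀ i : Fin (n + 1), (s i).KitsAt Wg S.p Δ' (δr n)) →
      η ≤ δr n / 2 →
      (∀ i : Fin (n + 1), (prodBernoulli Wg).real (⋃ t ∈ (s i).T \ T' i, openConn (s 0).L.o t) ≤ η) →
      1 - δr n < (prodBernoulli Wg).real (s 0).L.reachB →
        1 - S.δc < (prodBernoulli Wg).real (⋃ t ∈ T' (Fin.last n), openConn (s 0).L.o t))
    (hR : RootOblT X S Δ' δr) : RootObl (X □ zdGraph 2) S := by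
  intro du
  obtain ⟨n, π, U', s, T', η, hU', hroot, ho, hlink, hsub, hkits, hη, hexc, hsrc, hTn⟩ := hR du
  exact hQ0_of_chain_sub (tubeGraph X π) hU' hroot le_rfl (hchain n π) s T' ho hlink hsub hkits hη hexc hsrc hTn

omit [Countable W] in
/-- **`FaceOblAt` + the one-step property at `(δ₂ ↦ δc/2)` + the source bound ⟹ `cond`** (`cond_of_tubeStep`).
[cite: KozmaNitzan2024, §4 p. 30 (Step III), Lemma 10 (p. 17)] -/
theorem cond_of_faceOblAt {Δ' : ℕ} {δ₂ : ℝ} {j : ℕ} {o : Finset (Sym2 (W × Site 2))}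
    (hstep : ∀ (π : Finset W) (Wg : Sym2 (W × Site 2) → unitInterval) (s : KNLevels.TStep (tubeGraph X π)), s.KitsAt Wg S.p Δ' δ₂ →
      1 - δ₂ < (prodBernoulli Wg).real s.L.reachB → 1 - S.δc / 2 < (prodBernoulli Wg).real (⋃ t ∈ s.T, openConn s.L.o t))
    (hF : FaceOblAt X S FD Δ' δ₂ h e a a' du j o)
    (hsrc : 1 - δ₂ < (prodBernoulli (S.Wt (X □ zdGraph 2) h e a a' du j o)).real
      (⋃ b ∈ FD.Face a' (tgt e) du (j + 1), openConn S.Γ.root b)) :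
    S.cond (X □ zdGraph 2) h e a a' du j o := by
  obtain ⟨P, T', η, hroot, hsub, hfin, hDS, hencl, ho, hoS, hj, hTD, hTne, hcount, hkits, hT', hT'M, hexc, hη, hface⟩ := hF
  exact cond_of_tubeStep X P (hstep P.π) hroot hsub hfin hDS hencl ho hoS hj hTD hTne hcount hkits T' hT' hT'M hexc hη hface hsrc

/-- **`ReachOblAt` + the chain property at `(δ ↦ ε'')` + `δc ≤ δ` ⟹ the corridor bound `1 - ε'' < P_{Wfull}(Reach)`** (`hreach_of_tubeChain`).
[cite: KozmaNitzan2024, §4 Lemma 12 (pp. 23–25), p. 30 (Step IV)] -/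
theorem reach_of_reachOblAt (hV : S.Valid₂ (X □ zdGraph 2) h e) {Δ' : ℕ} {δ ε'' : ℝ} (hδc : S.δc ≤ δ)
    (hchain : ∀ (π : Finset W) (Wg : Sym2 (W × Site 2) → unitInterval)
      (s : Fin (ChainPlanar.Sched.nLast + 1) → KNLevels.TStep (tubeGraph X π))
      (T' : Fin (ChainPlanar.Sched.nLast + 1) → Finset (W × Site 2)) (η : ℝ),
      (∀ i, (s i).L.o = (s 0).L.o) →
      (∀ i : Fin ChainPlanar.Sched.nLast, T' (Fin.castSucc i) ⊆ (s i.succ).L.X 0) →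
      (∀ i, T' i ⊆ (s i).T) →
      (∀ i, (s i).KitsAt Wg S.p Δ' δ) →
      η ≤ δ / 2 →
      (∀ i, (prodBernoulli Wg).real (⋃ t ∈ (s i).T \ T' i, openConn (s 0).L.o t) ≤ η) →
      1 - δ < (prodBernoulli Wg).real (s 0).L.reachB →
        1 - ε'' < (prodBernoulli Wg).real (⋃ t ∈ T' (Fin.last ChainPlanar.Sched.nLast), openConn (s 0).L.o t))
    (hR : ReachOblAt X S FD Δ' δ h e a' du) :
    1 - ε'' < (prodBernoulli (S.Wfull (X □ zdGraph 2) h e (S.aOf₁ (X □ zdGraph 2) h e) a' du)).real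
      (S.Reach (X □ zdGraph 2) FD h e (S.aOf₁ (X □ zdGraph 2) h e) a' du) := by
  obtain ⟨P, π', η, hroot, hr, hR', hRl, hRim, hπ, hj, hcount, hsub, hfin, hDS, ho, hoS, hkits, hη, hexc, hπ', hM0, hMn⟩ := hR
  exact hreach_of_tubeChain X P hV hδc (hchain P.π) hroot hr hR' hRl hRim hπ hj hcount hsub hfin hDS ho hoS hkits hη hexc hπ' hM0 hMn

end KSchA

end KNCells

end Transplant

end Summit.CriticalPhenomena.PercolationContinuityZ3.Theorems

end
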